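import Summits.SmoothPoincare4.SmoothPoincare4.Theorems.EntropyRungCompactShrinkerGapJensenVolumeBound
import Summits.SmoothPoincare4.SmoothPoincare4.Theorems.CompactShrinkerGap.Negative.DensityPinning
import HarnessLib

/-!
# The hot region of a dense closed shrinker under the volume comparison
(line `cgy-variance-pivot`, door A‴ / STUB 25′ `stub_scalarLeTen_of_volume`, crux `EntropyRung.CompactShrinkerGap`,
item stmt-SmoothPoincare4-10870; registered helper `helper_hotRegionVolume`)

For a normalised gradient shrinker `Ric + Hess f = g/2`, `R + |∇f|² = f` (smooth `f`, Riemannian `g` with its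
Levi-Civita connection) on a closed 4-manifold with Gaussian mass `Z = ∫ e^{-f} dV > Z₀ = 32π²√π e^{-3/2}` (the
crux's density hypothesis) AND volume `Vol(M,g) ≤ 96π² = Vol(S⁴(√6))` (the conclusion of the registered open stub
`stub_volumeComparison`, the hypothesis added to STUB 25 by the tenth lead's reshape), the superlevel sets of the
potential are uniformly small:

  `(1 − (T − 1)e^{2−T}) · Vol{f ≥ T} ≤ 96π² − e²Z₀ = 96π² − 32π²√π e^{1/2}`   for every `T ≥ 2`

(numerically `≤ 2.49π² ≈ 24.6`; so `Vol{f ≥ 4} ≤ 41.4`, `Vol{f ≥ 6} ≤ 27.1`). This is the landed DENSITY PINNING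
(`CompactShrinkerGap.Negative.volume_superlevel_le`, p76440: from `∫ f e^{-f} = 2∫ e^{-f}` and a density floor
`(1 − ε)e^{-2}Vol ≤ Z`) instantiated on the crux data with the exact slack `ε = 1 − e²Z/Vol`, so that
`ε·Vol = Vol − e²Z < 96π² − e²Z₀`. It is the first, kernel-checked step of the "thin finger" picture behind STUB 25′
(skeleton v15.1 docstring): a violator of `R ≤ 10` must fit a gradient climb of length `≥ 2(√F − 2)` inside a region
of volume `≤ 41.4`. No Theses statement is concluded.

References: H.-D. Cao, R. S. Hamilton, T. Ilmanen, arXiv:math/0404165, §4; J. Carrillo, L. Ni, Comm. Anal. Geom. 17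
(2009), §4.
-/

noncomputable section

-- the registered namespace `Summit.SmoothPoincare4.SmoothPoincare4.Theorems` repeats a component (summit = sub-problem)
set_option linter.dupNamespace false

open MeasureTheory Set
open scoped Manifold ContDiff ENNReal Topology

namespace Summit.SmoothPoincare4.SmoothPoincare4.Theorems

open Literature.Geometry Literature.Geometry.Lorentzian Literature.Geometry.Riemannian
  Literature.Geometry.Lorentzian.PseudoRiemannianMetric

/-- **Hot-region volume bound (door A‴, registered helper `helper_hotRegionVolume`).** For a normalised gradient
shrinker on a closed 4-manifold with `∫ e^{-f} dV > 32π²√π e^{-3/2}` and `Vol(M,g) ≤ 96π²`: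
`(1 − (T − 1)e^{2−T}) · Vol{f ≥ T} ≤ 96π² − 32π²√π e^{1/2}` for every `T ≥ 2`. Proof: density pinning
(`volume_superlevel_le`) with `ε := 1 − e²Z/Vol` (so `(1 − ε)e^{-2}Vol = Z` exactly and `εVol = Vol − e²Z`), the identity
`∫ f e^{-f} = 2∫ e^{-f}` (`integral_mul_exp_neg_eq_two_mul`), `e²Z > e²Z₀ = 32π²√π e^{1/2}` and `Vol ≤ 96π²`.
[cite: CaoHamiltonIlmanen2004, §4] [cite: CarrilloNi2009, §4] -/
theorem helper_hotRegionVolume :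
    ∀ (M : Type) [TopologicalSpace M] [T2Space M] [SecondCountableTopology M]
      [ChartedSpace (EuclideanSpace ℝ (Fin 4)) M] [IsManifold (𝓡 4) ∞ M] [CompactSpace M]
      [T3Space M] [MeasurableSpace M] [BorelSpace M]
      (g : Literature.Geometry.Lorentzian.PseudoRiemannianMetric (𝓡 4) ∞ (EuclideanSpace ℝ (Fin 4))
        (TangentSpace (𝓡 4) : M → Type _)) [g.HasLeviCivita] (f : M → ℝ) (hg : g.IsRiemannian),
      ContMDiff (𝓡 4) 𝓘(ℝ, ℝ) ∞ f →
      (∀ (x : M) (X Y : TangentSpace (𝓡 4) x),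
        g.ricci x X Y + g.hessian f x X Y = (1 / 2 : ℝ) * g.val x X Y) →
      (∀ x : M, g.scalarCurvature x + g.gradSq f x = f x) →
      ENNReal.ofReal (32 * Real.pi ^ 2 * Real.sqrt Real.pi * Real.exp (-(3 : ℝ) / 2)) <
        ∫⁻ x, ENNReal.ofReal (Real.exp (-f x))
          ∂(Literature.Geometry.Lorentzian.riemannianMeasure (g.toContMDiffRiemannianMetric hg)) →
      ((Literature.Geometry.Lorentzian.riemannianMeasure (g.toContMDiffRiemannianMetric hg)) Set.univ).toReal ≤
        96 * Real.pi ^ 2 →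
      ∀ T : ℝ, 2 ≤ T →
        (1 - (T - 1) * Real.exp (2 - T)) *
            ((Literature.Geometry.Lorentzian.riemannianMeasure (g.toContMDiffRiemannianMetric hg))
              {x | T ≤ f x}).toReal ≤
          96 * Real.pi ^ 2 - 32 * Real.pi ^ 2 * Real.sqrt Real.pi * Real.exp (1 / 2) := by
  intro M _ _ _ _ _ _ _ _ _ g _ f hg hf hsol hnorm hdens hvol T hT
  set μ := riemannianMeasure (g.toContMDiffRiemannianMetric hg) with hμ
  haveI : IsFiniteMeasure μ :=
    ⟨riemannianVolume_lt_top_of_isCompact_holds (g.toContMDiffRiemannianMetric hg) le_rfl isCompact_univ⟩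
  have hV : g.riemVolume = μ := PseudoRiemannianMetric.riemVolume_eq hg
  -- the identity and the integrability/measurability of the integrands
  have hid := integral_mul_exp_neg_eq_two_mul M g f hg hf hsol hnorm
  have hint : Integrable (fun x ↦ Real.exp (-f x)) μ := hV ▸ integrable_exp_neg_of_contMDiff hf
  have hfint : Integrable (fun x ↦ f x * Real.exp (-f x)) μ :=
    hV ▸ g.integrable_of_continuous (hf.continuous.mul (Real.continuous_exp.comp hf.continuous.neg))
  have hfm : Measurable f := hf.continuous.measurable
  -- the density floor read on the Bochner integral `Z = ∫ e^{-f}`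
  set Z := ∫ x, Real.exp (-f x) ∂μ with hZ
  have hZ₀ : 32 * Real.pi ^ 2 * Real.sqrt Real.pi * Real.exp (-(3 : ℝ) / 2) < Z := by
    rw [← ofReal_integral_eq_lintegral_ofReal hint (ae_of_all _ fun x ↦ (Real.exp_pos _).le),
      ENNReal.ofReal_lt_ofReal_iff'] at hdens
    exact hdens.1
  -- the volume is positive (volume floor)
  set V := (μ Set.univ).toReal with hVdef
  have hVpos : 0 < V := by
    have h := volume_floor_of_density M g f hg hf hsol hnorm hdens
    exact lt_trans (by positivity) h
  -- density pinning with the exact slack `ε = 1 − e²Z/V`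
  set ε : ℝ := 1 - Z / (Real.exp (-2) * V) with hε
  have hεdens : (1 - ε) * (Real.exp (-2) * (μ Set.univ).toReal) ≤ ∫ x, Real.exp (-f x) ∂μ := by
    rw [← hVdef, ← hZ, hε]
    have hpos : 0 < Real.exp (-2) * V := by positivity
    rw [sub_sub_cancel, div_mul_cancel₀ _ hpos.ne']
  have hpin := CompactShrinkerGap.Negative.volume_superlevel_le μ f hfm hint hfint hid hεdens hT
  -- `ε V = V − e²Z`, `e²Z > 32π²√π e^{1/2}`, `V ≤ 96π²`
  have hεV : ε * (μ Set.univ).toReal = V - Real.exp 2 * Z := by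
    rw [← hVdef, hε]
    have hpos : 0 < Real.exp (-2) * V := by positivity
    have he : Real.exp (-2) * Real.exp 2 = 1 := by rw [← Real.exp_add]; norm_num
    field_simp
    linear_combination Z * he
  have hexp : Real.exp (1 / 2) = Real.exp 2 * Real.exp (-(3 : ℝ) / 2) := by
    rw [← Real.exp_add]; norm_num
  have hZ2 : 32 * Real.pi ^ 2 * Real.sqrt Real.pi * Real.exp (1 / 2) < Real.exp 2 * Z := by
    rw [hexp]
    have := mul_lt_mul_of_pos_left hZ₀ (Real.exp_pos 2)
    linarith [this]
  calc (1 - (T - 1) * Real.exp (2 - T)) * (μ {x | T ≤ f x}).toReal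
      ≤ ε * (μ Set.univ).toReal := hpin
    _ = V - Real.exp 2 * Z := hεV
    _ ≤ 96 * Real.pi ^ 2 - 32 * Real.pi ^ 2 * Real.sqrt Real.pi * Real.exp (1 / 2) := by linarith

end Summit.SmoothPoincare4.SmoothPoincare4.Theorems

end
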